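import Summits.BirchSwinnertonDyer.BirchSwinnertonDyer.Theorems.PrintX9JetchevX9SwapBridge
import Summits.BirchSwinnertonDyer.BirchSwinnertonDyer.Theorems.PrintX10bJetchevNode
import Summits.BirchSwinnertonDyer.BirchSwinnertonDyer.Theorems.PrintX10bJetchevCoreVertexExistence
import Summits.BirchSwinnertonDyer.Rank1Residual.X10.LeafDischargeX10b
import HarnessLib

/-!
# J₃ twin (crux 21340, route PrintX10b, rev 3b) of p4's X9 Jetchev chain — Thm. 5.2 at a core vertex with explicit binders, the PER-LEVEL inequality, and the registered stub `stub_carrierDepthX10b` of skeleton 3b (crux 21340) from the swap reading SwapX10b + THREE NAMED LITERATURE FACTS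

Cell `bsd-print-x9`, seat p3 g2 (idle-prover assignment, plan g3 20:01Z); `--supports stmt-BirchSwinnertonDyer-21340`;
THEOREMS ONLY, route-free (no `Theses` import), nothing booked, no item closed. This file is p4 g2's
`PrintX9JetchevX9SwapBridge.lean` with the X9 leaf binder `(hX9 : ClassX9 W p)` replaced by `(hX10 : ClassX10 W p)` (so `p = 3`,
good ordinary at 3, `E[3]` irreducible; the frame binders — `K` imaginary quadratic Heegner for `N_E` with `p` split,
`d_K ∉ {−3,−4}` — unchanged), the ClassX9 dot-lemmas replaced by ty2's ClassX10 twins of the SAME signature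
(files F/H/J/K of the discharge interface: `ClassX10.irr/ne_two`, `ClassX10.cor32_localOrder_of_heegner`,
`ClassX10.exists_kolyvaginPrime_addOrderOf_localization_eq(_shift)_of_heegner`), and every X9-chain theorem it calls
replaced by its twin in this series (`…classX10b…` / `…X10b…`, namespace `JET.SplitThree`); p4's p-GENERIC bricks
(`…_of_irreducible_of_split`, `…_of_prop37_2_of_split`, §6 abstractions) are imported, not copied. Statements and
proofs otherwise byte-for-byte. §3 is re-targeted: its conclusion is the planner's `stub_carrierDepthX10b` (HOME/plan/x10b3/bc/HeegnerDivisibilityX10b_birth3b.lean) VERBATIM — the carrier-depth regime of J₃ (one bad prime `q` with `s ≤ ord_3 c_q`), i.e. Jetchev's Thm. 1.4 shape at `p = 3`; `B := 4`; the rev-3b binder `d_K ≡ 1 (mod 8)` is threaded to the walk and the swap. CONDITIONAL exactly as the X9 original (named facts displayed as binders); nothing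
asserted about any curve. beyond-print: as the X9 original, now at `p = 3` on the rev-3b frames.
[cite: Jetchev2008, Thm. 1.4 (p. 812), Thm. 5.2, Prop. 5.3, proof of Thm. 1.1 (p. 824)] [cite: McCallumLMS1991, §5 Prop. 5.2 (p. 304)]
-/
set_option autoImplicit false

noncomputable section

open scoped Classical Pointwise

open WeierstrassCurve IsDedekindDomain NumberField Field Literature.NumberTheory.EllipticCurves
  Literature.NumberTheory.EllipticCurves.ModularForms Literature.NumberTheory.EllipticCurves.Jetchev2008
  Literature.NumberTheory.GaloisRepresentations Literature.NumberTheory.GaloisCohomology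
  Literature.NumberTheory.GaloisRepresentations.DiscreteGaloisModule
  Summit.BirchSwinnertonDyer.Rank1Residual.X11b Summit.BirchSwinnertonDyer.Rank1Residual.X11b.Three
  Summit.BirchSwinnertonDyer.Rank1Residual.JET
  Summit.BirchSwinnertonDyer.Rank1Residual.JET.SelmerVocabulary Literature.NumberTheory.Automorphic
  Summit.BirchSwinnertonDyer.BirchSwinnertonDyer.Theorems Literature.NumberTheory.EllipticCurves.Rank1Residual

namespace Summit.BirchSwinnertonDyer.Rank1Residual.JET.SplitThree

open Summit.BirchSwinnertonDyer.Rank1Residual.JET.Split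

/-! ### §1 The node with explicit binders (no minimality binders) -/

/-- **Jetchev Thm. 5.2 at a core vertex on an X9 Heegner frame, explicit binders**: for an X9 pair `(E, p)`, a Heegner field
`K` of `N_E` with `p` split and `d_K ∉ {−3,−4}`, `τ ≠ 1`, a frame `(Dt, β, ι)`, a carrier prime `q ∣ N_E`, depth functions
`m′`/`m` on the Zhang–Kolyvagin conductors, and a core vertex `c` of level `k` with `m(c) = μ < k`, `t < k`, `k + μ ≤ M(c)`:
`t = ord_p c_q ≤ μ`. The statement of `h63X10b_of_namedFacts` (`PrintX9JetchevX9Node`) without its two (unused) minimality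
binders and without the idle conductor-`1` datum; proof verbatim. CONDITIONAL on the three named facts.
[cite: Jetchev2008, Thm. 5.2 (p. 821) and proof, Prop. 4.9] [cite: McCallumLMS1991, §4 Prop. 4.4] -/
theorem tamagawaExponent_le_of_coreVertex_classX10b
    (h37 : GrossLMS1991.prop37_2_frobeniusCongruence)
    (hPT : ∀ (K : Type) [Field K] [NumberField K], poitouTate_selmerStructure_duality_conj K)
    (hF1 : Gross1991_heegnerPoint_sub_ratTorsion_mem_E0_imageFree)
    (W : WeierstrassCurve ℚ) [W.IsElliptic] [W.IsGloballyMinimal] [NeZero (W.conductorNorm ℤ)]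
    (K : Type) [Field K] [NumberField K] (hK : IsImaginaryQuadratic K)
    (hD3 : NumberField.discr K ≠ -3) (hD4 : NumberField.discr K ≠ -4)
    (hH : SatisfiesHeegnerHypothesis (W.conductorNorm ℤ) K) (τ : K ≃ₐ[ℚ] K) (hτ : τ ≠ 1)
    (p : ℕ) [Fact p.Prime] (hX10 : ClassX10 W p) (hHp : SatisfiesHeegnerHypothesis p K)
    (Dt : ModularParametrizationData W (W.conductorNorm ℤ)) (β : ℤ) (ι : K →+* ℂ)
    [∀ k : ℕ, NumberField (ringClassField K ι k)]
    (q : ℕ) [Fact q.Prime] (hq : q ∣ W.conductorNorm ℤ)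
    (mdiv m : {c : ℕ // Squarefree c ∧ ∀ ℓ ∈ c.primeFactors,
        Zhang2014.IsKolyvaginPrime (W.conductorNorm ℤ) W K p ℓ} → ℕ∞)
    (hmdiv : ∀ c (u : ℕ), (u : ℕ∞) ≤ mdiv c ↔ ∀ d : KolyvaginHeegnerData Dt β ι c.1,
      ∃ Q : (W.baseChange (ringClassField K ι c.1)).toAffine.Point,
        ((p ^ u : ℕ) : ℤ) • Q = d.derivedPoint)
    (hm : ∀ c, m c = if mdiv c < Zhang2014.levelIndex W p c.1 then mdiv c else ⊤)
    (mInf k : ℕ) (c : {c : ℕ // Squarefree c ∧ ∀ ℓ ∈ c.primeFactors,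
        Zhang2014.IsKolyvaginPrime (W.conductorNorm ℤ) W K p ℓ})
    (hk : 1 ≤ k) (hcore : Jetchev2008.IsGlobalCoreVertex W K ι τ p k c.1) (hmc : m c = mInf)
    (hkM : (k : ℕ∞) + mInf ≤ Zhang2014.levelIndex W p c.1)
    (htk : padicValNat p ((W.baseChange ℚ_[q]).localTamagawaNumber ℤ_[q]) < k) (hik : mInf < k) :
    padicValNat p ((W.baseChange ℚ_[q]).localTamagawaNumber ℤ_[q]) ≤ mInf := by
  have hp : p.Prime := Fact.out
  have hp2 : p ≠ 2 := hX10.ne_two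
  have hD : NumberField.discr K < -4 := KolyvaginAssembly.discr_lt_neg_four hK ⟨hD3, hD4⟩
  -- trivial case: `p ∤ c_q`
  by_cases ht0 : padicValNat p ((W.baseChange ℚ_[q]).localTamagawaNumber ℤ_[q]) = 0
  · rw [ht0]; exact Nat.zero_le _
  have hdvd : p ∣ (W.baseChange ℚ_[q]).localTamagawaNumber ℤ_[q] :=
    dvd_of_one_le_padicValNat (Nat.one_le_iff_ne_zero.mpr ht0)
  -- the carrier place `v₀ ∣ q`, split, and the transport of the row data
  obtain ⟨v₀, hv₀, hv₀N, hqv₀⟩ := exists_split_place_of_dvd K hK τ hτ hH q hq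
  obtain ⟨hminK, hminP, hcEq, hc0, hcyc⟩ := carrierRowData_of_split W K q hK τ v₀ hv₀ hqv₀
  haveI := hminK
  haveI := hminP
  haveI := hcyc (kodairaNeron_isAddCyclic_forall W q p hp2 hdvd)
  -- `τ² = 1`
  haveI : Algebra.IsQuadraticExtension ℚ K := ⟨hK.1⟩
  have hτ2 : τ * τ = 1 := by
    have hcard : Nat.card (K ≃ₐ[ℚ] K) = 2 := by rw [IsGalois.card_aut_eq_finrank, hK.1]
    obtain ⟨y, -, hyu⟩ := (Nat.card_eq_two_iff' (1 : K ≃ₐ[ℚ] K)).mp hcard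
    have h1 : τ = y := hyu τ hτ
    have h2 : τ⁻¹ = y := hyu τ⁻¹ (inv_ne_one.mpr hτ)
    rw [mul_eq_one_iff_eq_inv]
    exact h1.trans h2.symm
  -- instances at level `p^k`
  haveI : NeZero (p ^ k) := ⟨pow_ne_zero k hp.ne_zero⟩
  haveI : Finite (geomTorsion (W.baseChange K) ((p ^ k : ℕ) : ℤ)) :=
    finite_geomTorsion_of_neZero (W.baseChange K) (p ^ k)
  have hn : ((p ^ k : ℕ) : ℤ) ≠ 0 := by exact_mod_cast pow_ne_zero k hp.ne_zero
  -- the receptacle schema [GZ86 III (3.1)] at this frame, from the image-free named fact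
  obtain ⟨n', hcop', hGZ'⟩ := HeegnerE0ImageFree.hGZ_of_Gross1991_imageFree hF1 W K hK hD3 hD4 hH p hp2 hX10.irr Dt β ι
  -- Kolyvagin data of the core vertex
  have hc0' : c.1 ≠ 0 := c.2.1.ne_zero
  have hkc : (k : ℕ∞) ≤ Zhang2014.levelIndex W p c.1 := le_trans le_self_add hkM
  have hcK : ∀ ℓ ∈ c.1.primeFactors, Zhang2014.IsKolyvaginPrime (W.conductorNorm ℤ) W K p ℓ ∧
      k ≤ Zhang2014.kolyvaginIndex W p ℓ := fun ℓ hℓ ↦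
    ⟨c.2.2 ℓ hℓ, Zhang2014.natCast_le_levelIndex_iff.mp hkc ℓ hℓ⟩
  -- the exponent over `K_{v₀}` is the exponent over `ℚ_q`
  have hfac : (((W.baseChange K).baseChange (v₀.adicCompletion K)).localTamagawaNumber
      (v₀.adicCompletionIntegers K)).factorization p =
      padicValNat p ((W.baseChange ℚ_[q]).localTamagawaNumber ℤ_[q]) := by
    rw [hcEq, Nat.factorization_def _ hp]
  have htk' : (((W.baseChange K).baseChange (v₀.adicCompletion K)).localTamagawaNumber
      (v₀.adicCompletionIntegers K)).factorization p < k := by rw [hfac]; exact htk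
  -- the intrinsic transverse family (for `h49tr` from `htr` at level `cℓ`)
  obtain ⟨𝒯, h𝒯, hT⟩ := exists_localTransverseFamily W ι ((p ^ k : ℕ) : ℤ) hc0'
  have key := tamagawaExponent_le_mInfty_of_localFacts_of_classX10b_of_heegner h37 W
    K hK hD3 hD4 hH
    (hPT K) p hp2 hX10 hHp Dt β ι τ hτ hτ2 hcop' hGZ' mdiv m hmdiv hm k hn c hk hcore mInf hmc hkM hik
    v₀ hv₀ hv₀N hc0 htk'
    (fun 𝒯' h𝒯' ↦ conjActPlace_mem_transverseFamily_forall W K hK ι τ hτ p k hp2 c.1 c.2.1 hcK 𝒯' h𝒯')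
    (fun 𝒯' h𝒯' e hμ hadd₁ hadd₂ hgal halt hnondeg ↦
      RingClassTransverse.localTransverseFamily_selfDual_forall W K hK hD3 hD4 ι p k hp2 c.1 c.2.1 hcK 𝒯' h𝒯'
        e hμ hadd₁ hadd₂ hgal halt hnondeg)
    (fun ℓ h1 h2 _ v hv hfix s hs ↦
      kolyvaginLocalTerm_of_poitouTate hPT W K hK τ hτ p k hp2 hk ℓ h1 h2 v hv hfix s hs)
    (fun d ℓ hℓ ↦ kolyvaginClass_mem_transverseKer W hK hD hp2 Dt β ι k c.2.1 hcK d hℓ)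
    (fun ℓ h1 h2 h3 d' w hw ↦ by
      -- `h49tr` from `htr` at level `cℓ` through the reconciliation `hT`
      have hl : ℓ.Prime := h1.1
      have hlc : ¬ ℓ ∣ c.1 := fun h ↦ h3 (Nat.mem_primeFactors.mpr ⟨hl, h, hc0'⟩)
      have hcl : Squarefree (c.1 * ℓ) :=
        (Nat.squarefree_mul ((Nat.Prime.coprime_iff_not_dvd hl).mpr hlc).symm).mpr ⟨c.2.1, hl.squarefree⟩
      have hpf : (c.1 * ℓ).primeFactors = c.1.primeFactors ∪ {ℓ} := by
        rw [Nat.primeFactors_mul hc0' hl.ne_zero, hl.primeFactors]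
      have hcKℓ : ∀ l' ∈ (c.1 * ℓ).primeFactors, Zhang2014.IsKolyvaginPrime (W.conductorNorm ℤ) W K p l' ∧
          k ≤ Zhang2014.kolyvaginIndex W p l' := by
        intro l' hl'
        rw [hpf, Finset.mem_union, Finset.mem_singleton] at hl'
        rcases hl' with h | rfl
        · exact hcK l' h
        · exact ⟨h1, h2⟩
      rw [← h𝒯 w]
      refine (hT _).mpr (fun l' hl' ↦ ?_) w hw
      exact kolyvaginClass_mem_transverseKer W hK hD hp2 Dt β ι k hcl hcKℓ d'
        (by rw [hpf]; exact Finset.mem_union_left _ hl'))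
  rw [hfac] at key
  exact key

/-! ### §2 The per-level inequality `hlev` (`t < k`) on X9 frames -/

/-- **The per-level inequality on an X9 Heegner frame** (corner-p1's `hlev` binder with `t < k`): for every admissible
`(n, d)` (square-free Zhang–Kolyvagin conductor, any datum) with `m(n) < k`, `t < k` and `k + m(n) ≤ M(n)`: `t ≤ m(n)`
(`m(n) = ord_p(P_n)` if `< M(n)`, else `⊤`; `t = ord_p c_q`). PROOF: `m(n) = u < k` is finite, so `P_n` has exact depth
`u` and is of infinite order (`E(K[n])[p] = 0`, irreducibility + `p` split); the walk `coreVertexExistenceX10b_of_namedFacts`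
gives a core vertex `c'` of level `k` with a datum not `p^{u+1}`-divisible and all indices `≥ k + u`; with the depth function
`m′(c) = inf_d ord_p P_c(d)` one has `m(c') = μ ≤ u` and §1 at `c'` gives `t ≤ μ ≤ u`. The conductor-`1` datum `d₁` with
`y_K` of infinite order is an idle binder of the walk's statement. CONDITIONAL on the three named facts.
[cite: Jetchev2008, Prop. 5.3, Thm. 5.2, proof of Thm. 1.1 (p. 824)] -/
theorem perLevel_classX10b_of_namedFacts
    (h37 : GrossLMS1991.prop37_2_frobeniusCongruence)
    (hPT : ∀ (K : Type) [Field K] [NumberField K], poitouTate_selmerStructure_duality_conj K)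
    (hF1 : Gross1991_heegnerPoint_sub_ratTorsion_mem_E0_imageFree)
    (W : WeierstrassCurve ℚ) [W.IsElliptic] [W.IsGloballyMinimal] [NeZero (W.conductorNorm ℤ)]
    (K : Type) [Field K] [NumberField K] (hK : IsImaginaryQuadratic K)
    (hD3 : NumberField.discr K ≠ -3) (hD4 : NumberField.discr K ≠ -4)
    (hH : SatisfiesHeegnerHypothesis (W.conductorNorm ℤ) K)
    (p : ℕ) [Fact p.Prime] (hX10 : ClassX10 W p) (hHp : SatisfiesHeegnerHypothesis p K)
    (hd8 : NumberField.discr K % 8 = 1)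
    (Dt : ModularParametrizationData W (W.conductorNorm ℤ)) (β : ℤ) (ι : K →+* ℂ)
    [∀ k : ℕ, NumberField (ringClassField K ι k)]
    (d₁ : KolyvaginHeegnerData Dt β ι 1) (hy : ¬ IsOfFinAddOrder d₁.derivedPoint)
    (q : ℕ) [Fact q.Prime] (hq : q ∣ W.conductorNorm ℤ) :
    ∀ (k n : ℕ) (d : KolyvaginHeegnerData Dt β ι n), Squarefree n →
      (∀ ℓ ∈ n.primeFactors, Zhang2014.IsKolyvaginPrime (W.conductorNorm ℤ) W K p ℓ) →
      (if Koly.divOrd d p < Zhang2014.levelIndex W p n then Koly.divOrd d p else (⊤ : ℕ∞)) < (k : ℕ∞) →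
      padicValNat p ((W.baseChange ℚ_[q]).localTamagawaNumber ℤ_[q]) < k →
      (k : ℕ∞) + (if Koly.divOrd d p < Zhang2014.levelIndex W p n then Koly.divOrd d p else ⊤) ≤
        Zhang2014.levelIndex W p n →
      ((padicValNat p ((W.baseChange ℚ_[q]).localTamagawaNumber ℤ_[q]) : ℕ) : ℕ∞) ≤
        (if Koly.divOrd d p < Zhang2014.levelIndex W p n then Koly.divOrd d p else ⊤) := by
  intro k n d hn hkol hlt htk hkM
  have hp : p.Prime := Fact.out
  obtain ⟨τ, hτ⟩ := exists_algEquiv_ne_one_of_isImaginaryQuadratic K hK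
  -- `m(n)` is finite: `ord_p(P_n) = u < k`, `u < M(n)`, `k + u ≤ M(n)`
  have hfinlt : Koly.divOrd d p < Zhang2014.levelIndex W p n := by
    by_contra h
    rw [if_neg h] at hlt
    exact not_top_lt hlt
  rw [if_pos hfinlt] at hlt hkM ⊢
  obtain ⟨u, hu⟩ := ENat.ne_top_iff_exists.mp (ne_top_of_lt hfinlt)
  rw [← hu] at hlt hkM ⊢
  have huk : u < k := by exact_mod_cast hlt
  have hk : 1 ≤ k := by omega
  obtain ⟨hdvd, hndvd⟩ := Koly.exact_of_divOrd_eq_natCast d p hu.symm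
  -- `P_n` is of infinite order: `E(K[n])[p] = 0` (irreducibility, `p` split hence unramified in `K`, `p ∤ n`)
  have hn0 : n ≠ 0 := hn.ne_zero
  have hpc : ¬ p ∣ n := fun h ↦ (hkol p (Nat.mem_primeFactors.mpr ⟨hp, h, hn0⟩)).2.2.2.1 rfl
  have hbot := X11b.NoTorsionIrr.torsionBy_ringClassField_eq_bot_of_hasIrreducibleModPGaloisRep W hK ι hn0 hp
    hX10.ne_two hX10.irr (WeierstrassCurve.exists_weilPairing_holds W p)
    (X11b.isUnramifiedIn_of_satisfiesHeegnerHypothesis_of_dvd hK hHp hp (dvd_refl p)) hpc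
  have hA : ∀ R : (W.baseChange (ringClassField K ι n)).toAffine.Point, (p : ℤ) • R = 0 → R = 0 := by
    intro R hR
    have hmem : R ∈ AddSubgroup.torsionBy (W.baseChange (ringClassField K ι n)).toAffine.Point (p : ℤ) := by
      rw [mem_torsionBy_iff]
      exact hR
    rw [hbot] at hmem
    exact hmem
  have hnt : ¬ IsOfFinAddOrder d.derivedPoint :=
    fun hfin ↦ hndvd (exists_pow_smul_eq_of_isOfFinAddOrder hp hA hfin (u + 1))
  have hsM : ((u + k : ℕ) : ℕ∞) ≤ Zhang2014.levelIndex W p n := by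
    push_cast; rw [add_comm]; exact hkM
  -- the walk: a core vertex `c'` of level `k` above `n`
  obtain ⟨c', d', hsq', hℓ', hcore, -, hnd'⟩ := coreVertexExistenceX10b_of_namedFacts h37 hPT hF1 W K hK hD3 hD4 hH τ
    hτ p hX10 hHp hd8 Dt β ι d₁ hy k hk n d hn hkol u huk hnt hdvd hndvd hsM
  -- the depth function `m'(c) = inf_d ord_p P_c(d)` on the Zhang–Kolyvagin conductors and its characterisation
  let Dv : ∀ c : ℕ, ℕ → Prop := fun c v ↦ ∀ dd : KolyvaginHeegnerData Dt β ι c,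
    ∃ Q : (W.baseChange (ringClassField K ι c)).toAffine.Point, ((p ^ v : ℕ) : ℤ) • Q = dd.derivedPoint
  have hDv0 : ∀ c, Dv c 0 := fun c dd ↦ ⟨dd.derivedPoint, by simp⟩
  have hDvmono : ∀ c {a b : ℕ}, b ≤ a → Dv c a → Dv c b :=
    fun c a b hab h dd ↦ exists_pow_smul_eq_of_le p hab (h dd)
  let mdivN : ℕ → ℕ∞ := fun c ↦
    if h : ∃ v, ¬ Dv c v then ((Nat.find h - 1 : ℕ) : ℕ∞) else ⊤
  have hchar : ∀ (c v : ℕ), (v : ℕ∞) ≤ mdivN c ↔ Dv c v := by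
    intro c v
    by_cases h : ∃ v, ¬ Dv c v
    · have hfind0 : 0 < Nat.find h := by
        rw [Nat.find_pos]
        exact fun h0 ↦ h0 (hDv0 c)
      simp only [mdivN, dif_pos h, ENat.coe_le_coe]
      constructor
      · intro hv
        have hlt' : v < Nat.find h := by omega
        have := (Nat.lt_find_iff h v).mp hlt' v le_rfl
        simpa using this
      · intro hv
        have hlt' : v < Nat.find h := by
          rw [Nat.lt_find_iff]
          intro w hw hnw
          exact hnw (hDvmono c hw hv)
        omega
    · simp only [mdivN, dif_neg h, le_top, true_iff]
      exact not_not.mp (not_exists.mp h v)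
  let mdiv : {c : ℕ // Squarefree c ∧ ∀ ℓ ∈ c.primeFactors,
        Zhang2014.IsKolyvaginPrime (W.conductorNorm ℤ) W K p ℓ} → ℕ∞ := fun c ↦ mdivN c.1
  let m : {c : ℕ // Squarefree c ∧ ∀ ℓ ∈ c.primeFactors,
        Zhang2014.IsKolyvaginPrime (W.conductorNorm ℤ) W K p ℓ} → ℕ∞ := fun c ↦ if mdiv c < Zhang2014.levelIndex W p c.1 then mdiv c else ⊤
  -- the core vertex as a Zhang–Kolyvagin conductor; `m'(c') = μ ≤ u`, `k + μ ≤ M(c')`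
  let cc : {c : ℕ // Squarefree c ∧ ∀ ℓ ∈ c.primeFactors,
        Zhang2014.IsKolyvaginPrime (W.conductorNorm ℤ) W K p ℓ} := ⟨c', hsq', fun ℓ h ↦ (hℓ' ℓ h).1⟩
  have hle : mdiv cc ≤ (u : ℕ∞) := by
    have h1 : ¬ ((u + 1 : ℕ) : ℕ∞) ≤ mdiv cc := fun h ↦ hnd' ((hchar c' (u + 1)).mp h d')
    rw [not_le] at h1
    have h2 : mdiv cc < (u : ℕ∞) + 1 := by exact_mod_cast h1
    exact (ENat.lt_add_one_iff (ENat.coe_ne_top u)).mp h2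
  obtain ⟨μ, hμ⟩ := ENat.ne_top_iff_exists.mp (ne_top_of_le_ne_top (ENat.coe_ne_top u) hle)
  have hμu : μ ≤ u := by
    have : (μ : ℕ∞) ≤ u := hμ ▸ hle
    exact_mod_cast this
  have hM' : (k : ℕ∞) + μ ≤ Zhang2014.levelIndex W p c' := by
    have h1 : (((k + u : ℕ) : ℕ∞)) ≤ Zhang2014.levelIndex W p c' :=
      Zhang2014.natCast_le_levelIndex_iff.mpr fun ℓ h ↦ (hℓ' ℓ h).2
    calc (k : ℕ∞) + μ ≤ (k : ℕ∞) + u := add_le_add le_rfl (by exact_mod_cast hμu)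
      _ = ((k + u : ℕ) : ℕ∞) := by push_cast; rfl
      _ ≤ _ := h1
  have hlt' : mdiv cc < Zhang2014.levelIndex W p cc.1 := by
    refine lt_of_le_of_lt (hμ ▸ le_rfl : mdiv cc ≤ (μ : ℕ∞)) (lt_of_lt_of_le ?_ hM')
    have h1 : (μ : ℕ∞) < (μ : ℕ∞) + 1 := (ENat.lt_add_one_iff (ENat.coe_ne_top μ)).mpr le_rfl
    calc (μ : ℕ∞) < (μ : ℕ∞) + 1 := h1
      _ ≤ (k : ℕ∞) + μ := by
        rw [add_comm]
        exact add_le_add_left (by exact_mod_cast hk) _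
  have hmc : m cc = μ := by
    simp only [m, if_pos hlt']
    exact hμ.symm
  -- Thm. 5.2 at the core vertex
  have key := tamagawaExponent_le_of_coreVertex_classX10b h37 hPT hF1 W K hK hD3 hD4 hH τ hτ p hX10 hHp Dt β ι q hq
    mdiv m (fun c v ↦ hchar c.1 v) (fun c ↦ rfl) μ k cc hk hcore hmc hM' htk (lt_of_le_of_lt hμu huk)
  exact_mod_cast key.trans hμu

/-! ### §3 The registered stub `stub_carrierDepthX10b` of skeleton 3b from the swap reading and three named facts -/

/-- **`stub_carrierDepthX10b` (crux 21340 `HeegnerDivisibilityX10b`, rev 3b; the planner's birth skeleton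
`Cruxes/HeegnerDivisibilityX10b` line `birth3b`, registered signature VERBATIM as conclusion) ⟸ `SwapX10b` + {Gross 1991
Prop. 3.7 (2), Poitou–Tate for Selmer structures, [GZ86 III (3.1)] image-free}** — the CARRIER-DEPTH regime of J₃: on every
X10b Heegner frame of rev 3b (`p = 3` split, `d_K ≡ 1 (mod 8)`, `|d_K| > B := 4`) and every depth `s` carried by ONE bad
prime `q ∣ N_E` (`s ≤ ord_3 c_q(E/ℚ_q)`), every derived Heegner point `P_n` over Zhang–Kolyvagin conductors of index `≥ s` is
`3^s`-divisible in `E(K[n])` — Jetchev's Thm. 1.4 shape at the irreducible NON-surjective mod-3 image. `SwapX10b` (binder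
`hswapX10b`) is the `r`-free prime swap on these frames (PROVED from the three named facts in
`PrintX10bJetchevSwapOfNamedFacts`: `swapX10b_of_namedFacts`); the per-level inequality is §2; the deduction is p4's generic
`pDiv_of_swap_of_perLevel_lt`. The binders `¬ Surj W 3`, `¬ W.HasCM`, `W.analyticRank = 1`, `s ≤ ord_3 ∏ c_ℓ` of the stub
are idle here (the carrier-depth statement holds for every X10 pair on these frames). CONDITIONAL on `hswapX10b` and the three
named facts; nothing asserted. [cite: Jetchev2008, Thm. 1.4 (p. 812), proof of Thm. 1.1 (p. 824)]
[cite: McCallumLMS1991, §5 Prop. 5.2 (p. 304)] [cite: BurungaleEtAl2026, Prop. 2.2.1] -/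
theorem carrierDepthX10b_of_swapX10b_of_namedFacts
    (hswapX10b : ∀ (W : WeierstrassCurve ℚ) [W.IsElliptic] [W.IsGloballyMinimal] [NeZero (W.conductorNorm ℤ)],
        ∀ (K : Type) [Field K] [NumberField K], IsImaginaryQuadratic K →
        NumberField.discr K ≠ -3 → NumberField.discr K ≠ -4 →
        SatisfiesHeegnerHypothesis (W.conductorNorm ℤ) K →
        ∀ (p : ℕ) [Fact p.Prime], ClassX10 W p → SatisfiesHeegnerHypothesis p K →
        NumberField.discr K % 8 = 1 →
        ∀ (Dt : ModularParametrizationData W (W.conductorNorm ℤ)) (β : ℤ) (ι : K →+* ℂ)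
          (d₁ : KolyvaginHeegnerData Dt β ι 1), ¬ IsOfFinAddOrder d₁.derivedPoint →
        ∀ (M e : ℕ) (n : ℕ) (d : KolyvaginHeegnerData Dt β ι n), Squarefree n →
          (∀ ℓ ∈ n.primeFactors, Zhang2014.IsKolyvaginPrime (W.conductorNorm ℤ) W K p ℓ ∧
            M + 1 ≤ Zhang2014.kolyvaginIndex W p ℓ) →
          (∀ (n' : ℕ) (d' : KolyvaginHeegnerData Dt β ι n'), Squarefree n' →
            (∀ ℓ ∈ n'.primeFactors, Zhang2014.IsKolyvaginPrime (W.conductorNorm ℤ) W K p ℓ ∧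
              M + 1 ≤ Zhang2014.kolyvaginIndex W p ℓ) →
            Koly.PDiv d' p M) →
          ¬ Koly.PDiv d p (M + 1) →
          ∃ (n' : ℕ) (d' : KolyvaginHeegnerData Dt β ι n'), Squarefree n' ∧
            (∀ ℓ ∈ n'.primeFactors, Zhang2014.IsKolyvaginPrime (W.conductorNorm ℤ) W K p ℓ ∧
              e ≤ Zhang2014.kolyvaginIndex W p ℓ) ∧
            ¬ Koly.PDiv d' p (M + 1))
    -- THREE NAMED LITERATURE FACTS
    (h37 : GrossLMS1991.prop37_2_frobeniusCongruence)
    (hPT : ∀ (K : Type) [Field K] [NumberField K], poitouTate_selmerStructure_duality_conj K)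
    (hF1 : Gross1991_heegnerPoint_sub_ratTorsion_mem_E0_imageFree) :
    ∀ (W : WeierstrassCurve ℚ) [W.IsElliptic] [W.IsGloballyMinimal] [NeZero (W.conductorNorm ℤ)] (p : ℕ) [Fact p.Prime], Literature.NumberTheory.EllipticCurves.Rank1Residual.ClassX10 W p → ¬ Literature.NumberTheory.EllipticCurves.Rank1Residual.Surj W 3 → ¬ W.HasCM → W.analyticRank = 1 → ∃ B : ℕ, ∀ (K : Type) [Field K] [NumberField K] (Dt : Literature.NumberTheory.EllipticCurves.ModularForms.ModularParametrizationData W (W.conductorNorm ℤ)) (β : ℤ) (ι : K →+* ℂ), Literature.NumberTheory.EllipticCurves.IsImaginaryQuadratic K → B < (NumberField.discr K).natAbs → NumberField.discr K % 8 = 1 → Literature.NumberTheory.EllipticCurves.SatisfiesHeegnerHypothesis (W.conductorNorm ℤ) K → Literature.NumberTheory.EllipticCurves.SatisfiesHeegnerHypothesis p K → (4 * (W.conductorNorm ℤ : ℤ)) ∣ β ^ 2 - NumberField.discr K → ¬ (p : ℤ) ∣ Dt.c → ∀ (d₁ : Literature.NumberTheory.EllipticCurves.KolyvaginHeegnerData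 Dt β ι 1), ¬ IsOfFinAddOrder d₁.derivedPoint → ∀ (s : ℕ), (∃ (q : ℕ) (_ : Fact q.Prime), q ∣ W.conductorNorm ℤ ∧ s ≤ padicValNat p ((W.baseChange ℚ_[q]).localTamagawaNumber ℤ_[q])) → s ≤ padicValNat p W.tamagawaProduct → ∀ (n : ℕ) (d : Literature.NumberTheory.EllipticCurves.KolyvaginHeegnerData Dt β ι n), Squarefree n → (∀ ℓ ∈ n.primeFactors, Literature.NumberTheory.EllipticCurves.Zhang2014.IsKolyvaginPrime (W.conductorNorm ℤ) W K p ℓ ∧ s ≤ Literature.NumberTheory.EllipticCurves.Zhang2014.kolyvaginIndex W p ℓ) → ∃ Q : (W.baseChange (Literature.NumberTheory.EllipticCurves.ringClassField K ι n)).toAffine.Point, ((p ^ s : ℕ) : ℤ) • Q = d.derivedPoint := by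
  intro W _ _ _ p _ hX10 _ _ _
  refine ⟨4, ?_⟩
  intro K _ _ Dt β ι hK hBK hd8 hH hHp _ _ d₁ hy s hsq _ n d hn hℓ
  obtain ⟨q, hq, hqN, hs⟩ := hsq
  -- `|d_K| > 4` and `d_K < 0`: the two unit-rich fields are excluded
  have hneg : NumberField.discr K < 0 := IsImaginaryQuadratic.discr_neg hK
  have hD3 : NumberField.discr K ≠ -3 := by omega
  have hD4 : NumberField.discr K ≠ -4 := by omega
  haveI : ∀ k : ℕ, NumberField (ringClassField K ι k) := fun k ↦ numberField_ringClassField K hK ι k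
  exact pDiv_of_swap_of_perLevel_lt p _ (hswapX10b W K hK hD3 hD4 hH p hX10 hHp hd8 Dt β ι d₁ hy)
    (fun k n' d' hn' hkol hlt htk hkM ↦ perLevel_classX10b_of_namedFacts h37 hPT hF1 W K hK hD3 hD4 hH p hX10 hHp hd8
      Dt β ι d₁ hy q hqN k n' d' hn' hkol hlt htk hkM) s hs n d hn hℓ

end Summit.BirchSwinnertonDyer.Rank1Residual.JET.SplitThree

end
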